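import Summits.ABC.IUTFork.Repair.ObstructionSS28Budget
import HarnessLib

/-!
# IUT REPAIR branch → R-H (D-0079), abc-iut-rp-s2 lineage — `ObstructionSS28LabelCut`: the slack ledger for a UNIFORM LABEL CUT `j ≤ j₀`
# (seed cut (C1) of plan/rescue/R-H/START-HERE.md; FUNNEL-NOTES G2) — companion of `ObstructionSS28Window` p451819 / `ObstructionSS28Budget` p453881

PROOF-ONLY satellite (own namespace `Summit.ABC.IUTFork.Repair.ObstructionSS28LabelCut`; D-0012: 0 definitions, 0 `Prop` facts; abc-iut cell, rung
LADDER-ABC:A2.RP → A2.RESCUE-H; seat abc-iut-rp-s2 gen 4, ONE-WRITER lane «per-cell slack ledger σ + budget identities»). TAKES NO SIDE on [IUTchIII]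
Cor. 3.12 or on any author; candidate readings are bound hypotheses; typed ≠ proved; DEFS-FREEZE respected; inputs ⊆ the frozen FACT-LIST; standard axioms.
`σ_{i+1,v_ℚ} := logvol(ⁿ˒°𝒰_{i+1,v_ℚ}) − qLocal_{i+1,v_ℚ}`, `floor_{i+1,v_ℚ} := ((i+1)² − 1)·(−qLocal_{i+1,v_ℚ})` (spelled out, never defined).

WHAT THIS FILE ADDS. For the window «labels `j ≤ j₀` at EVERY place» the set-builder windows of the parent files collapse to «all places» / «no places»
label by label, so the ledger reads with plain `if`s over the labels:
* §8a `avg_eq_below_add_above` / **`statement_iff_label_budget`**: `Statement ↔ 0 ≤ PN(i ↦ [i+1 ≤ j₀]·Σᶠ_v σ) + PN(i ↦ [i+1 > j₀]·Σᶠ_v σ)` (`ThetaFinite`),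
  and `deficit_above_le_of_statement` (necessity). HONEST NOTE (k4): at Statement level the budget inequality IS the Corollary — I06⋆ cells at the low
  labels are logically IDLE for it (they license SET-level targets; for the volume target they only sign the low-label term, `surplus_below_nonneg_of_starBelow`);
  a candidate «I06⋆ at j ≤ j₀ ∧ budget» therefore RESTATES the Statement unless its budget is an EXPLICIT sufficient inequality, as in §8b.
* §8b **`statement_of_lowerIndexBelow_ge_floorMassAbove`** — the EXPLICIT SUFFICIENT label-cut door in table currency: containers reading with a LOWER
  container-volume law `(i+1)²·qLocal + δ⁻ ≤ logvol(⋃_m ρ(Ψ_m·𝓘))` at the labels `≤ j₀` (the table's `slack_minus` there), honest scaling at the labels `> j₀`,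
  and `PN(i ↦ [i+1 > j₀]·Σᶠ_v floor) ≤ PN(i ↦ [i+1 ≤ j₀]·Σᶠ_v (δ⁻ − floor))` ⟹ Statement; no I06⋆, nothing about the hull above `j₀`
  (`ObstructionSS28Budget.cellSlack_ge_neg_floor_at`). This is NOT equivalent to the Statement (it discards all inflation above `j₀`).
* §8c `floorMassAbove_eq_of_indep`: with a label-independent q-volume the high-label floor mass is EXPLICIT,
  `PN(i ↦ [i+1 > j₀]·Σᶠ_v floor) = PN(i ↦ [i+1 > j₀]·((i+1)² − 1)) · (−(−|log(q)|))` — FUNNEL-NOTES G2's «off-window demand share» in kernel form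
  (its ratio to `c(l⋇)·|log q|`, `c(l⋇) = PN(j²) − 1`, is `Σ_{j>j₀}(j²−1) / Σ_j (j²−1)`).
HONEST SCOPE. Pure bookkeeping over the frozen vocabulary; nothing decides a genuine cell; the container law of §8b is an INLINE hypothesis on the binder `δ⁻`.
[claim: Mochizuki2012, status: disputed] [cite: ScholzeStix2018, §2.2 p. 10 l. 26–30]. Axioms: standard.
-/

noncomputable section

open Set

namespace Summit.ABC.IUTFork.Repair.ObstructionSS28LabelCut

open Thm311 Cor312 Cor312Vol Literature.IUT.LogThetaLattice Summit.ABC.IUTFork.Repair.CandInternal2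
  Summit.ABC.IUTFork.Repair.CandInternal11Gap Summit.ABC.IUTFork.Repair.CandInternal11GapWindow
  Summit.ABC.IUTFork.Repair.ObstructionSS28Window Summit.ABC.IUTFork.Repair.ObstructionSS28Budget

variable {T : ThetaIndex} (S : LatticeSituation T) (P : Cor312.Setting S.toSituation)
  (ρ : (∀ v : T.V, v ∈ T.Vbad → Set (S.L.StarPacket v)) → ∀ (j : T.Label) (vQ : T.VQ), Set (S.L.Packet j vQ))
  (qK : ∀ v : T.V, v ∈ T.Vbad → Set (S.L.StarPacket v)) (j₀ : ℕ)

/-! ## §8a. The label split of the ledger -/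

/-- A procession-normalised average splits into the labels `≤ j₀` and the labels `> j₀`. [folklore] -/
theorem avg_eq_below_add_above (f : Fin T.lstar → ℝ) :
    processionNormalized f =
      processionNormalized (fun i : Fin T.lstar => if (i : ℕ) + 1 ≤ j₀ then f i else 0) +
        processionNormalized (fun i : Fin T.lstar => if (i : ℕ) + 1 ≤ j₀ then 0 else f i) := by
  unfold processionNormalized
  rw [← add_div, ← Finset.sum_add_distrib]
  congr 1
  refine Finset.sum_congr rfl fun i _ => ?_
  by_cases hi : (i : ℕ) + 1 ≤ j₀
  · simp only [if_pos hi, add_zero]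
  · simp only [if_neg hi, zero_add]

/-- **LABEL BUDGET.** For every cut `j₀` and every setting with `ThetaFinite`:
`Statement ↔ 0 ≤ PN(i ↦ [i+1 ≤ j₀]·Σᶠ_v σ_{i+1,v}) + PN(i ↦ [i+1 > j₀]·Σᶠ_v σ_{i+1,v})`. HONEST NOTE: this inequality IS the Corollary — a candidate that
ASSUMES it restates the Statement (k4); I06⋆ cells below `j₀` only SIGN the first term (`surplus_below_nonneg_of_starBelow`). [claim: Mochizuki2012, status: disputed] -/
theorem statement_iff_label_budget (hfin : P.ThetaFinite) :
    P.Statement ↔ 0 ≤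
      processionNormalized (fun i : Fin T.lstar => if (i : ℕ) + 1 ≤ j₀ then
          ∑ᶠ vQ : T.VQ, ((S.D P.n).logvol _ vQ (P.thetaHull (Setting.labelSucc i) vQ) - P.qLocal (Setting.labelSucc i) vQ) else 0) +
        processionNormalized (fun i : Fin T.lstar => if (i : ℕ) + 1 ≤ j₀ then 0 else
          ∑ᶠ vQ : T.VQ, ((S.D P.n).logvol _ vQ (P.thetaHull (Setting.labelSucc i) vQ) - P.qLocal (Setting.labelSucc i) vQ)) := by
  rw [statement_iff_avg_cellSlack S P hfin, ← avg_eq_below_add_above]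

/-- **The low-label surplus is nonnegative under I06⋆ at the labels `≤ j₀`** (q-pin, RP-I05, bridge hypotheses) — the only thing I06⋆ contributes
at Statement level. [claim: Mochizuki2012, status: disputed] -/
theorem surplus_below_nonneg_of_starBelow (HB : BridgeHyps P) (hq : QPinned S P ρ qK) (hA : HInd3Hull S P ρ)
    (hon : ∀ (i : Fin T.lstar) (vQ : T.VQ), (i : ℕ) + 1 ≤ j₀ →
      ρ qK (Setting.labelSucc i) vQ ⊆ ⋃ m : ℤ, ρ (shellSat S P.n ((S.col P.n).frobΨ m)) (Setting.labelSucc i) vQ) :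
    0 ≤ processionNormalized (fun i : Fin T.lstar => if (i : ℕ) + 1 ≤ j₀ then
        ∑ᶠ vQ : T.VQ, ((S.D P.n).logvol _ vQ (P.thetaHull (Setting.labelSucc i) vQ) - P.qLocal (Setting.labelSucc i) vQ) else 0) := by
  have hl : 0 < T.lstar := lt_of_lt_of_le (by norm_num) T.two_le_lstar
  calc (0 : ℝ) = processionNormalized (fun _ : Fin T.lstar => (0 : ℝ)) := (processionNormalized_const hl 0).symm
    _ ≤ _ := processionNormalized_mono fun i => by
        split_ifs with hi
        · exact finsum_nonneg fun vQ => cellSlack_nonneg_of_starAt S P ρ qK HB hq hA i vQ (hon i vQ hi)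
        · exact le_rfl

/-- **Necessity: the Corollary forces «high-label deficit ≤ low-label surplus»** for every cut (`ThetaFinite`). [claim: Mochizuki2012, status: disputed] -/
theorem deficit_above_le_of_statement (hfin : P.ThetaFinite) (hS : P.Statement) :
    -processionNormalized (fun i : Fin T.lstar => if (i : ℕ) + 1 ≤ j₀ then 0 else
          ∑ᶠ vQ : T.VQ, ((S.D P.n).logvol _ vQ (P.thetaHull (Setting.labelSucc i) vQ) - P.qLocal (Setting.labelSucc i) vQ)) ≤
      processionNormalized (fun i : Fin T.lstar => if (i : ℕ) + 1 ≤ j₀ then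
          ∑ᶠ vQ : T.VQ, ((S.D P.n).logvol _ vQ (P.thetaHull (Setting.labelSucc i) vQ) - P.qLocal (Setting.labelSucc i) vQ) else 0) := by
  have h := (statement_iff_label_budget S P j₀ hfin).1 hS
  linarith

/-! ## §8b. The explicit sufficient label-cut door (table currency; no I06⋆, nothing about the hull above `j₀`) -/

/-- Label by label ABOVE the cut, the slack sum is at least minus the floor sum (`ObstructionSS28Budget.cellSlack_ge_neg_floor_at` pointwise; bridge
hypotheses, (ii)(b), Θ-pin, honest scaling at that label). [claim: Mochizuki2012, status: disputed] -/
theorem finsum_cellSlack_ge_neg_finsum_floor (HB : BridgeHyps P) (hKumB : (S.col P.n).KummerB (S.D P.n)) (hΘ : ThetaPinned S P ρ)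
    (i : Fin T.lstar)
    (hscaled : ∀ vQ : T.VQ, (S.D P.n).logvol _ vQ (ρ (S.D P.n).Ψ (Setting.labelSucc i) vQ) =
      (((i : ℕ) + 1 : ℕ) : ℝ) ^ 2 * P.qLocal (Setting.labelSucc i) vQ) :
    -∑ᶠ vQ : T.VQ, ((((i : ℕ) + 1 : ℕ) : ℝ) ^ 2 - 1) * (-P.qLocal (Setting.labelSucc i) vQ) ≤
      ∑ᶠ vQ : T.VQ, ((S.D P.n).logvol _ vQ (P.thetaHull (Setting.labelSucc i) vQ) - P.qLocal (Setting.labelSucc i) vQ) := by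
  rw [← finsum_neg_distrib]
  exact finsum_le_finsum' ((floor_support_finite S P i).subset (Function.support_neg _).le)
    (cellSlack_support_finite S P HB.finite i) fun vQ => cellSlack_ge_neg_floor_at S P ρ HB hKumB hΘ i vQ (hscaled vQ)

/-- Label by label BELOW the cut, in the containers reading with a lower container-volume law `(i+1)²·qLocal + δ⁻ ≤ logvol(container)` (`δ⁻` finitely
supported), the slack sum is at least `Σᶠ_v (δ⁻ − floor)`. [claim: Mochizuki2012, status: disputed] -/
theorem finsum_cellSlack_ge_finsum_lowerIndex_sub_floor (hfin : P.ThetaFinite) (δlo : Fin T.lstar → T.VQ → ℝ) (i : Fin T.lstar)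
    (hδ : (Function.support (δlo i)).Finite)
    (hhull : ∀ vQ : T.VQ, P.thetaHull (Setting.labelSucc i) vQ = ⋃ m : ℤ, ρ (shellSat S P.n ((S.col P.n).frobΨ m)) (Setting.labelSucc i) vQ)
    (hcont : ∀ vQ : T.VQ, (((i : ℕ) + 1 : ℕ) : ℝ) ^ 2 * P.qLocal (Setting.labelSucc i) vQ + δlo i vQ ≤
      (S.D P.n).logvol _ vQ (⋃ m : ℤ, ρ (shellSat S P.n ((S.col P.n).frobΨ m)) (Setting.labelSucc i) vQ)) :
    ∑ᶠ vQ : T.VQ, (δlo i vQ - ((((i : ℕ) + 1 : ℕ) : ℝ) ^ 2 - 1) * (-P.qLocal (Setting.labelSucc i) vQ)) ≤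
      ∑ᶠ vQ : T.VQ, ((S.D P.n).logvol _ vQ (P.thetaHull (Setting.labelSucc i) vQ) - P.qLocal (Setting.labelSucc i) vQ) := by
  refine finsum_le_finsum' ?_ (cellSlack_support_finite S P hfin i) fun vQ => ?_
  · refine (hδ.union (floor_support_finite S P i)).subset fun vQ hvQ => ?_
    by_contra hn
    simp only [Set.mem_union, Function.mem_support, not_or, not_not] at hn
    exact hvQ (by simp only [hn.1, hn.2, sub_zero])
  · have hc := hcont vQ
    rw [← hhull vQ] at hc
    show _ ≤ _
    linarith

/-- **THE EXPLICIT SUFFICIENT LABEL-CUT DOOR.** Bridge hypotheses, Thm. 3.11 (ii)(b), the Θ-pin; at the labels `≤ j₀` the containers reading (hull =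
log-shell orbit of the Θ-data) with a finitely supported LOWER container-volume law `δ⁻` (the table's sufficient exponent, `slack_minus` currency); at the
labels `> j₀` honest `j²`-scaling ONLY. If the low-label guaranteed surplus pays the high-label floor mass,
`PN(i ↦ [i+1 > j₀]·Σᶠ_v floor) ≤ PN(i ↦ [i+1 ≤ j₀]·Σᶠ_v (δ⁻ − floor))`, the typed Statement holds. No I06⋆ hypothesis; nothing about the hull above `j₀`.
NOT equivalent to the Statement (all inflation above `j₀` is discarded). [claim: Mochizuki2012, status: disputed] -/
theorem statement_of_lowerIndexBelow_ge_floorMassAbove (HB : BridgeHyps P) (hKumB : (S.col P.n).KummerB (S.D P.n)) (hΘ : ThetaPinned S P ρ)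
    (δlo : Fin T.lstar → T.VQ → ℝ) (hδ : ∀ i : Fin T.lstar, (Function.support (δlo i)).Finite)
    (hhull : ∀ (i : Fin T.lstar) (vQ : T.VQ), (i : ℕ) + 1 ≤ j₀ →
      P.thetaHull (Setting.labelSucc i) vQ = ⋃ m : ℤ, ρ (shellSat S P.n ((S.col P.n).frobΨ m)) (Setting.labelSucc i) vQ)
    (hcont : ∀ (i : Fin T.lstar) (vQ : T.VQ), (i : ℕ) + 1 ≤ j₀ →
      (((i : ℕ) + 1 : ℕ) : ℝ) ^ 2 * P.qLocal (Setting.labelSucc i) vQ + δlo i vQ ≤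
        (S.D P.n).logvol _ vQ (⋃ m : ℤ, ρ (shellSat S P.n ((S.col P.n).frobΨ m)) (Setting.labelSucc i) vQ))
    (hscaled : ∀ (i : Fin T.lstar) (vQ : T.VQ), j₀ < (i : ℕ) + 1 →
      (S.D P.n).logvol _ vQ (ρ (S.D P.n).Ψ (Setting.labelSucc i) vQ) = (((i : ℕ) + 1 : ℕ) : ℝ) ^ 2 * P.qLocal (Setting.labelSucc i) vQ)
    (hbudget : processionNormalized (fun i : Fin T.lstar => if (i : ℕ) + 1 ≤ j₀ then 0 else
          ∑ᶠ vQ : T.VQ, ((((i : ℕ) + 1 : ℕ) : ℝ) ^ 2 - 1) * (-P.qLocal (Setting.labelSucc i) vQ)) ≤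
      processionNormalized (fun i : Fin T.lstar => if (i : ℕ) + 1 ≤ j₀ then
          ∑ᶠ vQ : T.VQ, (δlo i vQ - ((((i : ℕ) + 1 : ℕ) : ℝ) ^ 2 - 1) * (-P.qLocal (Setting.labelSucc i) vQ)) else 0)) :
    P.Statement := by
  rw [statement_iff_avg_cellSlack S P HB.finite]
  -- the label-wise lower ledger `g`
  have hg : processionNormalized (fun i : Fin T.lstar => if (i : ℕ) + 1 ≤ j₀ then
        ∑ᶠ vQ : T.VQ, (δlo i vQ - ((((i : ℕ) + 1 : ℕ) : ℝ) ^ 2 - 1) * (-P.qLocal (Setting.labelSucc i) vQ))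
      else -∑ᶠ vQ : T.VQ, ((((i : ℕ) + 1 : ℕ) : ℝ) ^ 2 - 1) * (-P.qLocal (Setting.labelSucc i) vQ)) ≤
      processionNormalized (fun i : Fin T.lstar =>
        ∑ᶠ vQ : T.VQ, ((S.D P.n).logvol _ vQ (P.thetaHull (Setting.labelSucc i) vQ) - P.qLocal (Setting.labelSucc i) vQ)) :=
    processionNormalized_mono fun i => by
      split_ifs with hi
      · exact finsum_cellSlack_ge_finsum_lowerIndex_sub_floor S P ρ HB.finite δlo i (hδ i) (fun vQ => hhull i vQ hi)
          fun vQ => hcont i vQ hi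
      · exact finsum_cellSlack_ge_neg_finsum_floor S P ρ HB hKumB hΘ i fun vQ => hscaled i vQ (not_le.mp hi)
  -- `PN g = PN(low part) − PN(high floor mass)`
  have hsplit : processionNormalized (fun i : Fin T.lstar => if (i : ℕ) + 1 ≤ j₀ then
        ∑ᶠ vQ : T.VQ, (δlo i vQ - ((((i : ℕ) + 1 : ℕ) : ℝ) ^ 2 - 1) * (-P.qLocal (Setting.labelSucc i) vQ))
      else -∑ᶠ vQ : T.VQ, ((((i : ℕ) + 1 : ℕ) : ℝ) ^ 2 - 1) * (-P.qLocal (Setting.labelSucc i) vQ)) =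
      processionNormalized (fun i : Fin T.lstar => if (i : ℕ) + 1 ≤ j₀ then
          ∑ᶠ vQ : T.VQ, (δlo i vQ - ((((i : ℕ) + 1 : ℕ) : ℝ) ^ 2 - 1) * (-P.qLocal (Setting.labelSucc i) vQ)) else 0) -
        processionNormalized (fun i : Fin T.lstar => if (i : ℕ) + 1 ≤ j₀ then 0 else
          ∑ᶠ vQ : T.VQ, ((((i : ℕ) + 1 : ℕ) : ℝ) ^ 2 - 1) * (-P.qLocal (Setting.labelSucc i) vQ)) := by
    unfold processionNormalized
    rw [← sub_div, ← Finset.sum_sub_distrib]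
    congr 1
    refine Finset.sum_congr rfl fun i _ => ?_
    by_cases hi : (i : ℕ) + 1 ≤ j₀
    · simp only [if_pos hi, sub_zero]
    · simp only [if_neg hi, zero_sub]
  rw [hsplit] at hg
  linarith

/-! ## §8c. With a label-independent q-volume the high-label floor mass is explicit -/

/-- Label by label, with a label-independent q-volume (abc-iut-w4-d103's `finsum_qLocal_eq_negLogQ`), the floor sum at label `i+1` is
`((i+1)² − 1)·(−(−|log(q)|))`. [claim: Mochizuki2012, status: disputed] -/
theorem finsum_floor_eq_of_indep
    (hindep : ∀ (i i' : Fin T.lstar) (vQ : T.VQ), P.qLocal (Setting.labelSucc i) vQ = P.qLocal (Setting.labelSucc i') vQ)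
    (i : Fin T.lstar) :
    ∑ᶠ vQ : T.VQ, ((((i : ℕ) + 1 : ℕ) : ℝ) ^ 2 - 1) * (-P.qLocal (Setting.labelSucc i) vQ) =
      ((((i : ℕ) + 1 : ℕ) : ℝ) ^ 2 - 1) * (-P.negLogQ) := by
  rw [← mul_finsum, finsum_neg_distrib, PinnedHonest.finsum_qLocal_eq_negLogQ S P hindep i]

/-- **THE HIGH-LABEL FLOOR MASS IS EXPLICIT** under a label-independent q-volume:
`PN(i ↦ [i+1 > j₀]·Σᶠ_v floor) = PN(i ↦ [i+1 > j₀]·((i+1)² − 1)) · (−(−|log(q)|))` — FUNNEL-NOTES G2's off-window demand share (its ratio to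
`c(l⋇)·|log(q)|` is `Σ_{j > j₀} (j² − 1) / Σ_j (j² − 1)`). [claim: Mochizuki2012, status: disputed] -/
theorem floorMassAbove_eq_of_indep
    (hindep : ∀ (i i' : Fin T.lstar) (vQ : T.VQ), P.qLocal (Setting.labelSucc i) vQ = P.qLocal (Setting.labelSucc i') vQ) :
    processionNormalized (fun i : Fin T.lstar => if (i : ℕ) + 1 ≤ j₀ then 0 else
        ∑ᶠ vQ : T.VQ, ((((i : ℕ) + 1 : ℕ) : ℝ) ^ 2 - 1) * (-P.qLocal (Setting.labelSucc i) vQ)) =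
      processionNormalized (fun i : Fin T.lstar => if (i : ℕ) + 1 ≤ j₀ then (0 : ℝ) else ((((i : ℕ) + 1 : ℕ) : ℝ) ^ 2 - 1)) *
        (-P.negLogQ) := by
  simp only [finsum_floor_eq_of_indep S P hindep]
  unfold processionNormalized
  rw [div_mul_eq_mul_div, Finset.sum_mul]
  congr 1
  refine Finset.sum_congr rfl fun i _ => ?_
  by_cases hi : (i : ℕ) + 1 ≤ j₀
  · simp only [if_pos hi, zero_mul]
  · simp only [if_neg hi]

/-- **The explicit sufficient door with the explicit floor mass** (label-independent q-volume): low-label guaranteed surplus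
`≥ PN(i ↦ [i+1 > j₀]·((i+1)² − 1)) · (−(−|log(q)|))` ⟹ Statement. [claim: Mochizuki2012, status: disputed] -/
theorem statement_of_lowerIndexBelow_ge_explicitFloorMass (HB : BridgeHyps P) (hKumB : (S.col P.n).KummerB (S.D P.n)) (hΘ : ThetaPinned S P ρ)
    (hindep : ∀ (i i' : Fin T.lstar) (vQ : T.VQ), P.qLocal (Setting.labelSucc i) vQ = P.qLocal (Setting.labelSucc i') vQ)
    (δlo : Fin T.lstar → T.VQ → ℝ) (hδ : ∀ i : Fin T.lstar, (Function.support (δlo i)).Finite)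
    (hhull : ∀ (i : Fin T.lstar) (vQ : T.VQ), (i : ℕ) + 1 ≤ j₀ →
      P.thetaHull (Setting.labelSucc i) vQ = ⋃ m : ℤ, ρ (shellSat S P.n ((S.col P.n).frobΨ m)) (Setting.labelSucc i) vQ)
    (hcont : ∀ (i : Fin T.lstar) (vQ : T.VQ), (i : ℕ) + 1 ≤ j₀ →
      (((i : ℕ) + 1 : ℕ) : ℝ) ^ 2 * P.qLocal (Setting.labelSucc i) vQ + δlo i vQ ≤
        (S.D P.n).logvol _ vQ (⋃ m : ℤ, ρ (shellSat S P.n ((S.col P.n).frobΨ m)) (Setting.labelSucc i) vQ))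
    (hscaled : ∀ (i : Fin T.lstar) (vQ : T.VQ), j₀ < (i : ℕ) + 1 →
      (S.D P.n).logvol _ vQ (ρ (S.D P.n).Ψ (Setting.labelSucc i) vQ) = (((i : ℕ) + 1 : ℕ) : ℝ) ^ 2 * P.qLocal (Setting.labelSucc i) vQ)
    (hbudget : processionNormalized (fun i : Fin T.lstar => if (i : ℕ) + 1 ≤ j₀ then (0 : ℝ) else ((((i : ℕ) + 1 : ℕ) : ℝ) ^ 2 - 1)) *
        (-P.negLogQ) ≤
      processionNormalized (fun i : Fin T.lstar => if (i : ℕ) + 1 ≤ j₀ then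
          ∑ᶠ vQ : T.VQ, (δlo i vQ - ((((i : ℕ) + 1 : ℕ) : ℝ) ^ 2 - 1) * (-P.qLocal (Setting.labelSucc i) vQ)) else 0)) :
    P.Statement :=
  statement_of_lowerIndexBelow_ge_floorMassAbove S P ρ j₀ HB hKumB hΘ δlo hδ hhull hcont hscaled
    (by rw [floorMassAbove_eq_of_indep S P j₀ hindep]; exact hbudget)

end Summit.ABC.IUTFork.Repair.ObstructionSS28LabelCut

end
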